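import Summits.BirchSwinnertonDyer.BirchSwinnertonDyer.Theorems.ResidualThetaTransportAtTwoResidualSignedLambdaLowerCMAtTwoCofreeSelmerTransferKummer
import Summits.BirchSwinnertonDyer.BirchSwinnertonDyer.Theorems.ResidualThetaTransportAtTwoResidualSignedLambdaLowerCMAtTwoCofreeSelmerTransfer
import Summits.BirchSwinnertonDyer.BirchSwinnertonDyer.Theorems.ThetaPartnerAtTwoSignedTransportAtTwoResidualKummer
import Literature.NumberTheory.EllipticCurves.ZpExtensionSubgroupH1LayerExhaustionProofs
import Literature.NumberTheory.EllipticCurves.OrdinaryNewformDatumCofreeUnramified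
import Literature.NumberTheory.EllipticCurves.H1TrivialAction
import HarnessLib

/-!
# Sketch (stub-ideation `sidea-stub_cmLambdaLower-3-g16`, k = 3, technique «decomposition») — EH-DESCENT

Crux `ResidualThetaCountLowerPureAtTwo` (stmt-BirchSwinnertonDyer-26074), stub `stub_cmLambdaLower` = RSL_g
`ResidualSignedLambdaLowerCMAtTwo` (stmt-22608), line «onepair», S76 split of `stub_onePairSupply`, node **EH `stub_reciprocity`**
(`c₂ (locd₂ x) (loc₂ s) + cS (locdS x) (locS s) = 0` for `x ∈ I.H`, `s ∈ SelRel`).  This file TYPES (and partly PROVES) the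
decomposition proposed on the card `Ideas/stub-cmlambdalower-k3-g16.md`:

  EH ⟸ **D1** global descent of the TEST class `s ∈ H¹(Γ_∞, A_ρ)` to `b ∈ H¹(Γ_n, A_ρ[p^k])`, `τ_{n,k} b = s`, `n ≥ n₀`, `k ≥ k₀` (§1, PROVED)
     + **D2** admissibility of ANY descended class off `S₀ ∪ {p}` in Kato's dialect (§2, PROVED; converse of (T)_ρ `transferH1_mem_unramifiedOutside`)
     + **D3** naturality `res_{D ⊓ Γ_∞} ∘ τ = ι_* ∘ res_{D ⊓ Γ_∞ ≤ Γ_n}` for every `D ≤ Γ_ℚ` (§2, PROVED)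
     + **K2** local level shift at `v ∣ p`, **K1** `ker(H¹(U_m, A_ρ[p^k]) → H¹(U_m, A_ρ))` = Θ-Kummer classes of torsion tuples,
       **DescKumAt** (the [kum] reading `layerLocOf b = thetaLayerKummer Q₁` of a descended class) (§3, typed `Prop`s)
     + EH-lev (levelwise Poitou–Tate, landed receptacle) + READ (the pins' value clauses) — glued at ONE deep level (§0, PROVED, pure logic).

Everything is stated over existing declarations; no `sorry`; sketch-local `def`s are `Prop`s or abbreviations only.
BSD is NOT proved by any of this; RSL_g (22608) and the crux (26074) stay OPEN.

References: [GreenbergLNM1716] §3 Lemma 3.2, §1; [SerreGaloisCohomology1997] I §2.2 Prop. 8, I §2.4, I §5.1; [NeukirchSchmidtWingberg2008]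
(1.5.1), (8.6.10); [GreenbergVatsal2000] §2; [Kato2004Asterisque] §8.2; [Kobayashi2003] §2, (8.23); [Washington1997] Prop. 13.2.
-/

set_option autoImplicit false
set_option linter.dupNamespace false

noncomputable section

open scoped Classical NumberField

namespace Summit.BirchSwinnertonDyer.BirchSwinnertonDyer.Cruxes.ResidualThetaCountLowerPureAtTwo.SideaK3G16

open Field IsDedekindDomain NumberField
  Literature.NumberTheory.EllipticCurves Literature.NumberTheory.GaloisRepresentations
  Literature.NumberTheory.EllipticCurves.GreenbergSelmer Literature.NumberTheory.EllipticCurves.GreenbergVatsal2000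
  Literature.NumberTheory.EllipticCurves.Kobayashi2003 Literature.NumberTheory.EllipticCurves.CyclotomicLayer
  Literature.NumberTheory.GaloisCohomology ZpExtension
  Summit.BirchSwinnertonDyer.BirchSwinnertonDyer.Theorems
  Summit.BirchSwinnertonDyer.BirchSwinnertonDyer.Theorems.ThetaTransport.CofreeSelmerTransfer

/-! ## §0 The glue of the decomposition (pure logic): EH at `∞` read off ONE deep level -/

section Glue

/-- **EH ⟸ DESC + EH-lev + READ.** `T₂, T_S` are the two EH summands at `∞` (functions of the pair `(x, s)`), `Good s ℓ` says
«`ℓ = (n, k, b, …)` is a descent datum of `s`», `t₂, t_S` are the levelwise local terms.  If every `s` has a descent datum (D1 +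
D2 + DescKum), the levelwise terms of a datum sum to zero (levelwise reciprocity, the `∞`/off-`S₀` terms being zero or folded in),
and the pins READ the `∞`-summands as the levelwise terms of ANY datum of `s`, then EH holds — no limit in the level is needed,
because both summands are exact values in `ℚ/ℤ`. [cite: NeukirchSchmidtWingberg2008, (8.6.10)] -/
theorem eh_of_descent {X S L V : Type*} [AddCommGroup V] (T₂ TS : X → S → V) (Good : S → L → Prop)
    (t₂ tS : X → L → V) (hdesc : ∀ s, ∃ ℓ, Good s ℓ) (hlev : ∀ x s ℓ, Good s ℓ → t₂ x ℓ + tS x ℓ = 0)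
    (hread₂ : ∀ x s ℓ, Good s ℓ → T₂ x s = t₂ x ℓ) (hreadS : ∀ x s ℓ, Good s ℓ → TS x s = tS x ℓ) :
    ∀ x s, T₂ x s + TS x s = 0 := fun x s ↦ by
  obtain ⟨ℓ, hℓ⟩ := hdesc s
  rw [hread₂ x s ℓ hℓ, hreadS x s ℓ hℓ]
  exact hlev x s ℓ hℓ

end Glue

/-! ## §1 D1 — GLOBAL DESCENT of the test class (PROVED) -/

section Global

variable {p : ℕ} [Fact p.Prime] (S : Set (PadicAlgCl p)) {d : ℕ} (ρ : FramedGaloisRep ℚ ↥(padicCoeffIntegers S) d)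
  (κ : ZpExtension ℚ p)

/-- The points of `A_ρ[N]` have open stabilisers (the stabiliser of `m ∈ A_ρ[N]` is that of `m ∈ A_ρ`, `isOpen_stabilizer_cofree`).
[cite: Greenberg1989, §1 p. 98] -/
theorem isOpen_stabilizer_cofreeTorsion (N : ℤ) (m : ↥(AddSubgroup.torsionBy (Cofree ρ ↥(padicCoeffField S)) N)) :
    IsOpen (MulAction.stabilizer (absoluteGaloisGroup ℚ) m : Set (absoluteGaloisGroup ℚ)) := by
  have e : (MulAction.stabilizer (absoluteGaloisGroup ℚ) m : Set (absoluteGaloisGroup ℚ)) =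
      MulAction.stabilizer (absoluteGaloisGroup ℚ) (m : Cofree ρ ↥(padicCoeffField S)) := by
    ext g
    simp only [SetLike.mem_coe, MulAction.mem_stabilizer_iff, Subtype.ext_iff]
    exact Iff.rfl
  rw [e]
  exact isOpen_stabilizer_cofree S ρ _

/-- `A_ρ[N]` is `p`-primary (it sits in the `p`-primary `A_ρ`, `exists_pow_smul_cofree_eq_zero`). [cite: GreenbergLNM1716, §1] -/
theorem exists_pow_smul_cofreeTorsion_eq_zero (N : ℤ) (m : ↥(AddSubgroup.torsionBy (Cofree ρ ↥(padicCoeffField S)) N)) :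
    ∃ k : ℕ, p ^ k • m = 0 := by
  obtain ⟨k, hk⟩ := exists_pow_smul_cofree_eq_zero S ρ (m : Cofree ρ ↥(padicCoeffField S))
  exact ⟨k, Subtype.ext (by rw [AddSubmonoidClass.coe_nsmul, ZeroMemClass.coe_zero]; exact hk)⟩

/-- **(ii) coefficient descent at `∞`**: every class of `H¹(Γ_∞, A_ρ)` killed by `p^k` is `ι_* s'` for some `s' ∈ H¹(Γ_∞, A_ρ[p^k])`
(Kummer surjectivity `H¹(A[p^k]) ↠ H¹(A)[p^k]` for the divisible `A_ρ`, `SignedTransportAtTwo.mem_range_pushH1_of_nsmul_eq_zero`).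
[cite: SerreGaloisCohomology1997, I §2.2] [cite: GreenbergLNM1716, §2 p. 71] -/
theorem exists_pushH1_torsionBy_eq_of_pow_smul_eq_zero (k : ℕ) (s : subgroupH1 κ.kerSubgroup (Cofree ρ ↥(padicCoeffField S)))
    (hk : p ^ k • s = 0) :
    ∃ s' : subgroupH1 κ.kerSubgroup ↥(AddSubgroup.torsionBy (Cofree ρ ↥(padicCoeffField S)) ((p ^ k : ℕ) : ℤ)),
      pushH1 κ.kerSubgroup (AddSubgroup.torsionBy (Cofree ρ ↥(padicCoeffField S)) ((p ^ k : ℕ) : ℤ)).subtype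
        (torsionBy_subtype_smul S ρ ((p ^ k : ℕ) : ℤ)) s' = s := by
  have hp : (p ^ k : ℕ) ≠ 0 := pow_ne_zero k (Fact.out : p.Prime).ne_zero
  obtain ⟨s', hs'⟩ := SignedTransportAtTwo.mem_range_pushH1_of_nsmul_eq_zero (G := ↥κ.kerSubgroup)
    (AddSubgroup.torsionBy (Cofree ρ ↥(padicCoeffField S)) ((p ^ k : ℕ) : ℤ)).subtype
    (fun g x ↦ torsionBy_subtype_smul S ρ ((p ^ k : ℕ) : ℤ) g x) Subtype.val_injective
    (fun m hm ↦ ⟨⟨m, (Submodule.mem_torsionBy_iff _ m).mpr (by rw [natCast_zsmul]; exact hm)⟩, rfl⟩)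
    (Cofree.divisible ↥(padicCoeffField S) ρ hp)
    (fun m ↦ (continuous_smul_of_isOpen_stabilizer' (Cofree ρ ↥(padicCoeffField S)) (isOpen_stabilizer_cofree S ρ) m).comp
      continuous_subtype_val)
    hk
  exact ⟨s', hs'⟩

/-- **D1 (global descent of the test class).** Every `s ∈ H¹(Γ_∞, A_ρ)` is a transfer `τ_{n,k} b = res_{Γ_∞ ≤ Γ_n}(ι_* b)` of a
class `b ∈ H¹(Γ_n, A_ρ[p^k])` from a level `n ≥ n₀` as deep as we please, with `k ≥ k₀` as large as we please: `s` is `p^k`-torsion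
(`exists_pow_smul_subgroupH1_eq_zero`), comes from `H¹(Γ_∞, A_ρ[p^k])` ((ii)), and `H¹(Γ_∞, A_ρ[p^k]) = ⋃_n res H¹(Γ_n, A_ρ[p^k])`
(Greenberg's Lemma 3.2 / `H¹(lim← ·) = lim→ H¹`, `ZpExtension.exists_mem_range_resOfLe_of_le`); `res ∘ ι_* = ι_* ∘ res`.  This is the
CONVERSE direction of every transfer landed so far (k3-g13 (T)_ρ, T3♮, S4₂/S4₀ assemblies all go level → `∞`).
[cite: GreenbergLNM1716, §3 Lemma 3.2 and §1 (PDF p. 60)] [cite: SerreGaloisCohomology1997, I §2.2 Prop. 8] [cite: NeukirchSchmidtWingberg2008, (1.5.1)] -/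
theorem exists_transferH1_eq (n₀ k₀ : ℕ) (s : subgroupH1 κ.kerSubgroup (Cofree ρ ↥(padicCoeffField S))) :
    ∃ n : ℕ, n₀ ≤ n ∧ ∃ k : ℕ, k₀ ≤ k ∧
      ∃ b : subgroupH1 (κ.layerSubgroup n) ↥(AddSubgroup.torsionBy (Cofree ρ ↥(padicCoeffField S)) ((p ^ k : ℕ) : ℤ)),
        resOfLe (Cofree ρ ↥(padicCoeffField S)) (κ.kerSubgroup_le_layerSubgroup n)
          (pushH1 (κ.layerSubgroup n) (AddSubgroup.torsionBy (Cofree ρ ↥(padicCoeffField S)) ((p ^ k : ℕ) : ℤ)).subtype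
            (torsionBy_subtype_smul S ρ ((p ^ k : ℕ) : ℤ)) b) = s := by
  -- a torsion exponent `k ≥ k₀`
  obtain ⟨k₁, hk₁⟩ := exists_pow_smul_subgroupH1_eq_zero κ (Cofree ρ ↥(padicCoeffField S)) (exists_pow_smul_cofree_eq_zero S ρ) s
  have hk : p ^ (k₁ + k₀) • s = 0 := by rw [pow_add, mul_comm, mul_smul, hk₁, smul_zero]
  -- coefficient descent at `∞`, then layer exhaustion for the finite-exponent module `A_ρ[p^k]`
  obtain ⟨s', rfl⟩ := exists_pushH1_torsionBy_eq_of_pow_smul_eq_zero S ρ κ (k₁ + k₀) s hk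
  obtain ⟨n, hn, b, hb⟩ := exists_mem_range_resOfLe_of_le κ
    ↥(AddSubgroup.torsionBy (Cofree ρ ↥(padicCoeffField S)) ((p ^ (k₁ + k₀) : ℕ) : ℤ))
    (isOpen_stabilizer_cofreeTorsion S ρ _) (exists_pow_smul_cofreeTorsion_eq_zero S ρ _) n₀ s'
  refine ⟨n, hn, k₁ + k₀, Nat.le_add_left k₀ k₁, b, ?_⟩
  rw [ThetaTransport.resOfLe_pushH1 _ (torsionBy_subtype_smul S ρ ((p ^ (k₁ + k₀) : ℕ) : ℤ)) (κ.kerSubgroup_le_layerSubgroup n) b, hb]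

/-! ## §2 D3 — NATURALITY of localisation with the transfer, and D2 — ADMISSIBILITY of any descended class (PROVED) -/

/-- **D3 (naturality).** For every subgroup `D ≤ Γ_ℚ` (a decomposition group at `w ∈ S₀` or at `2`, an inertia group, …):
`res_{D ⊓ Γ_∞}(τ_{n,N} b) = ι_* (res_{D ⊓ Γ_∞ ≤ Γ_n} b)` — restriction is transitive and commutes with `ι_*`.  With `D = D_w` this is the
S₀-naturality the pins `locAway s w c = jAway w m k (loc_w^{(m)} (conj_c b))` need; with `D = D_2` the 2-adic one.
[cite: SerreGaloisCohomology1997, I §2.4] [cite: NeukirchSchmidtWingberg2008, I §5] -/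
theorem resOfLe_inf_transferH1_eq (N : ℤ) (n : ℕ) (D : Subgroup (absoluteGaloisGroup ℚ))
    (b : subgroupH1 (κ.layerSubgroup n) ↥(AddSubgroup.torsionBy (Cofree ρ ↥(padicCoeffField S)) N)) :
    resOfLe (Cofree ρ ↥(padicCoeffField S)) (inf_le_right : D ⊓ κ.kerSubgroup ≤ κ.kerSubgroup)
        (resOfLe (Cofree ρ ↥(padicCoeffField S)) (κ.kerSubgroup_le_layerSubgroup n)
          (pushH1 (κ.layerSubgroup n) (AddSubgroup.torsionBy (Cofree ρ ↥(padicCoeffField S)) N).subtype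
            (torsionBy_subtype_smul S ρ N) b)) =
      resH1Hom (ContinuousMonoidHom.id ↥(D ⊓ κ.kerSubgroup)) (AddSubgroup.torsionBy (Cofree ρ ↥(padicCoeffField S)) N).subtype
        (fun g y ↦ torsionBy_subtype_smul S ρ N g y)
        (resOfLe ↥(AddSubgroup.torsionBy (Cofree ρ ↥(padicCoeffField S)) N)
          ((inf_le_right : D ⊓ κ.kerSubgroup ≤ κ.kerSubgroup).trans (κ.kerSubgroup_le_layerSubgroup n)) b) := by
  have e := congrArg (fun f ↦ f (pushH1 (κ.layerSubgroup n) (AddSubgroup.torsionBy (Cofree ρ ↥(padicCoeffField S)) N).subtype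
      (torsionBy_subtype_smul S ρ N) b))
    (resOfLe_comp_holds (M := Cofree ρ ↥(padicCoeffField S)) (inf_le_right : D ⊓ κ.kerSubgroup ≤ κ.kerSubgroup)
      (κ.kerSubgroup_le_layerSubgroup n))
  simp only [AddMonoidHom.coe_comp, Function.comp_apply] at e
  rw [e, ThetaTransport.resOfLe_pushH1 _ (torsionBy_subtype_smul S ρ N) _ b]

/-- Inertia at a place where `ρ` is unramified acts trivially on `A_ρ = Fⁿ/𝒪ⁿ` (`σ • (x mod 𝒪ⁿ) = (ρ(σ) x) mod 𝒪ⁿ`, `ρ(σ) = 1`).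
[cite: EmertonPollackWeston2006, §3.1 (arXiv:math/0404484 p. 17)] -/
theorem smul_eq_self_of_mem_inertia {w : HeightOneSpectrum (𝓞 ℚ)} (hρw : ρ.IsUnramifiedAt w)
    {𝔓 : Ideal (absIntegers (𝓞 ℚ) ℚ)} (h𝔓 : 𝔓 ∈ w.primesAbove) {σ : absoluteGaloisGroup ℚ}
    (hσ : σ ∈ 𝔓.inertia (absoluteGaloisGroup ℚ)) (a : Cofree ρ ↥(padicCoeffField S)) : σ • a = a := by
  obtain ⟨x, rfl⟩ := cofreeMk_surjective ↥(padicCoeffField S) ρ a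
  rw [smul_cofreeMk, fracRepresentation_apply_apply, hρw 𝔓 h𝔓 σ hσ, Units.val_one,
    Matrix.map_one _ (map_zero _) (map_one _), Matrix.one_mulVec]

omit [Fact p.Prime] in
/-- **`ι_*` is injective on `H¹` of a subgroup acting trivially** (`H¹ = Hom` there and `ι` is injective): for `H' ≤ Γ_ℚ` acting trivially
on `M` and an injective equivariant `i : N → M`, `i_* : H¹(H', N) → H¹(H', M)` is injective. [cite: SerreGaloisCohomology1997, I §2.3] -/
theorem pushH1_injective_of_trivial {M N : Type} [AddCommGroup M] [DistribMulAction (absoluteGaloisGroup ℚ) M] [TopologicalSpace M]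
    [DiscreteTopology M] [AddCommGroup N] [DistribMulAction (absoluteGaloisGroup ℚ) N] [TopologicalSpace N] [DiscreteTopology N]
    (H' : Subgroup (absoluteGaloisGroup ℚ)) (i : N →+ M) (hi : ∀ (g : absoluteGaloisGroup ℚ) (x : N), i (g • x) = g • i x)
    (hinj : Function.Injective i) (htriv : ∀ (g : ↥H') (m : M), g • m = m) :
    Function.Injective (resH1Hom (ContinuousMonoidHom.id ↥H') i (fun g y ↦ hi g y)) := by
  have htrivN : ∀ (g : ↥H') (x : N), g • x = x := fun g x ↦ hinj ((hi g x).trans (htriv g (i x)))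
  rw [injective_iff_map_eq_zero]
  intro c hc
  obtain ⟨φ, rfl⟩ := oneCocycleClass_surjective _ c
  rw [resH1Hom_id_oneCocycleClass, oneCocycleClass_eq_zero_iff_of_trivial htriv] at hc
  rw [oneCocycleClass_eq_zero_iff_of_trivial htrivN]
  apply Subtype.ext
  ext g
  have h := congrArg (fun ψ : contOneCocycles (discreteTopRep (↥H') M) ↦ ψ.1 g) hc
  exact hinj ((h : i (φ.1 g) = 0).trans (map_zero i).symm)

/-- **D2 (admissibility of ANY descended class, Kato's dialect).** If `τ_{n,N} b` lies in `unramifiedOutside Γ_∞ A_ρ p S₀` (clause (1) of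
RSL_g's relaxed set `SelRel`) and `ρ` is unramified off `S₀ ∪ {p}`, then `b` dies on `Γ_n ⊓ I_𝔓` for EVERY `𝔓 ∣ v ∉ S₀ ∪ {v ∣ p}` — the
hypothesis (E1a) of (T)_ρ / of the levelwise reciprocity.  Proof: `I_𝔓 ≤ Γ_∞ ≤ Γ_n` (the layers are unramified outside `p`,
`inertia_le_kerSubgroup_holds`), the GV condition in its all-primes form (`resOfLe_inertia_inf_eq_zero_of_mem_unramifiedOutside`), D3 with
`D = I_𝔓`, and injectivity of `ι_*` on `H¹(I_𝔓 ⊓ Γ_∞, ·)` where `I_𝔓` acts trivially (`ρ` unramified).  CONVERSE of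
`CofreeSelmerTransfer.transferH1_mem_unramifiedOutside`. [cite: GreenbergVatsal2000, §2 pp. 16–17, 23] [cite: Kato2004Asterisque, §8.2 (p. 181)]
[cite: Washington1997, Prop. 13.2] [cite: SerreGaloisCohomology1997, I §5.1] -/
theorem admissible_of_transferH1_mem_unramifiedOutside {S₀ : Set (HeightOneSpectrum (𝓞 ℚ))}
    (hρ : ∀ w : HeightOneSpectrum (𝓞 ℚ), w ∉ S₀ → ((p : ℕ) : 𝓞 ℚ) ∉ w.asIdeal → ρ.IsUnramifiedAt w) (N : ℤ) (n : ℕ)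
    (b : subgroupH1 (κ.layerSubgroup n) ↥(AddSubgroup.torsionBy (Cofree ρ ↥(padicCoeffField S)) N))
    (hb : resOfLe (Cofree ρ ↥(padicCoeffField S)) (κ.kerSubgroup_le_layerSubgroup n)
        (pushH1 (κ.layerSubgroup n) (AddSubgroup.torsionBy (Cofree ρ ↥(padicCoeffField S)) N).subtype (torsionBy_subtype_smul S ρ N) b) ∈
      unramifiedOutside κ.kerSubgroup (Cofree ρ ↥(padicCoeffField S)) p S₀) :
    ∀ v ∉ S₀ ∪ {v | ((p : ℕ) : 𝓞 ℚ) ∈ v.asIdeal}, ∀ 𝔓 ∈ v.primesAbove,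
      resLe (cofreeTorsionGaloisModule S ρ N).toTopRep
        (inf_le_left : κ.layerSubgroup n ⊓ 𝔓.inertia (absoluteGaloisGroup ℚ) ≤ κ.layerSubgroup n) 1 b = 0 := by
  intro v hv 𝔓 h𝔓
  simp only [Set.mem_union, Set.mem_setOf_eq, not_or] at hv
  obtain ⟨hvS, hvp⟩ := hv
  -- `I_𝔓 ≤ Γ_∞` (the layers of `κ` are unramified outside `p`)
  have hI : 𝔓.inertia (absoluteGaloisGroup ℚ) ≤ κ.kerSubgroup := inertia_le_kerSubgroup_holds ℚ p κ hvp h𝔓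
  -- the transferred class dies on `I_𝔓 ⊓ Γ_∞`; read through D3 with `D = I_𝔓`
  have h0 := GreenbergVatsal2000.resOfLe_inertia_inf_eq_zero_of_mem_unramifiedOutside hb hvS hvp h𝔓
  rw [resOfLe_inf_transferH1_eq S ρ κ N n (𝔓.inertia (absoluteGaloisGroup ℚ)) b] at h0
  -- `I_𝔓 ⊓ Γ_∞` acts trivially on `A_ρ`, so `ι_*` is injective on its `H¹`
  have htriv : ∀ (g : ↥(𝔓.inertia (absoluteGaloisGroup ℚ) ⊓ κ.kerSubgroup)) (m : Cofree ρ ↥(padicCoeffField S)), g • m = m :=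
    fun g m ↦ smul_eq_self_of_mem_inertia S ρ (hρ v hvS hvp) h𝔓 (Subgroup.mem_inf.1 g.2).1 m
  have h1 : resOfLe ↥(AddSubgroup.torsionBy (Cofree ρ ↥(padicCoeffField S)) N)
      ((inf_le_right : 𝔓.inertia (absoluteGaloisGroup ℚ) ⊓ κ.kerSubgroup ≤ κ.kerSubgroup).trans (κ.kerSubgroup_le_layerSubgroup n)) b = 0 :=
    (injective_iff_map_eq_zero _).1 (pushH1_injective_of_trivial (𝔓.inertia (absoluteGaloisGroup ℚ) ⊓ κ.kerSubgroup)
      (AddSubgroup.torsionBy (Cofree ρ ↥(padicCoeffField S)) N).subtype (torsionBy_subtype_smul S ρ N) Subtype.val_injective htriv) _ h0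
  -- `I_𝔓 ⊓ Γ_n ≤ I_𝔓 ⊓ Γ_∞` (the same group), then Kato's dialect
  have h3 : 𝔓.inertia (absoluteGaloisGroup ℚ) ⊓ κ.layerSubgroup n ≤ 𝔓.inertia (absoluteGaloisGroup ℚ) ⊓ κ.kerSubgroup :=
    fun g hg ↦ Subgroup.mem_inf.2 ⟨(Subgroup.mem_inf.1 hg).1, hI (Subgroup.mem_inf.1 hg).1⟩
  have e := congrArg (fun f ↦ f b) (resOfLe_comp_holds (M := ↥(AddSubgroup.torsionBy (Cofree ρ ↥(padicCoeffField S)) N)) h3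
    ((inf_le_right : 𝔓.inertia (absoluteGaloisGroup ℚ) ⊓ κ.kerSubgroup ≤ κ.kerSubgroup).trans (κ.kerSubgroup_le_layerSubgroup n)))
  simp only [AddMonoidHom.coe_comp, Function.comp_apply] at e
  have e' : resOfLe ↥(AddSubgroup.torsionBy (Cofree ρ ↥(padicCoeffField S)) N)
      (inf_le_right : 𝔓.inertia (absoluteGaloisGroup ℚ) ⊓ κ.layerSubgroup n ≤ κ.layerSubgroup n) b =
      resOfLe ↥(AddSubgroup.torsionBy (Cofree ρ ↥(padicCoeffField S)) N) h3
        (resOfLe ↥(AddSubgroup.torsionBy (Cofree ρ ↥(padicCoeffField S)) N)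
          ((inf_le_right : 𝔓.inertia (absoluteGaloisGroup ℚ) ⊓ κ.kerSubgroup ≤ κ.kerSubgroup).trans (κ.kerSubgroup_le_layerSubgroup n)) b) :=
    e.symm
  rw [ThetaTransport.resLe_inf_eq_zero_iff_resOfLe_inf_eq_zero, e', h1, map_zero]

/-- **D1 + D2 assembled for a test class of clause (1)**: every `s ∈ unramifiedOutside Γ_∞ A_ρ p S₀` is `τ_{n,k} b` with `n ≥ n₀`, `k ≥ k₀`
and `b` ADMISSIBLE off `S₀ ∪ {p}` (Kato's dialect). [cite: GreenbergLNM1716, §3 Lemma 3.2] [cite: GreenbergVatsal2000, §2] -/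
theorem exists_admissible_transferH1_eq {S₀ : Set (HeightOneSpectrum (𝓞 ℚ))}
    (hρ : ∀ w : HeightOneSpectrum (𝓞 ℚ), w ∉ S₀ → ((p : ℕ) : 𝓞 ℚ) ∉ w.asIdeal → ρ.IsUnramifiedAt w) (n₀ k₀ : ℕ)
    (s : subgroupH1 κ.kerSubgroup (Cofree ρ ↥(padicCoeffField S)))
    (hs : s ∈ unramifiedOutside κ.kerSubgroup (Cofree ρ ↥(padicCoeffField S)) p S₀) :
    ∃ n : ℕ, n₀ ≤ n ∧ ∃ k : ℕ, k₀ ≤ k ∧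
      ∃ b : subgroupH1 (κ.layerSubgroup n) ↥(AddSubgroup.torsionBy (Cofree ρ ↥(padicCoeffField S)) ((p ^ k : ℕ) : ℤ)),
        resOfLe (Cofree ρ ↥(padicCoeffField S)) (κ.kerSubgroup_le_layerSubgroup n)
            (pushH1 (κ.layerSubgroup n) (AddSubgroup.torsionBy (Cofree ρ ↥(padicCoeffField S)) ((p ^ k : ℕ) : ℤ)).subtype
              (torsionBy_subtype_smul S ρ ((p ^ k : ℕ) : ℤ)) b) = s ∧
          ∀ v ∉ S₀ ∪ {v | ((p : ℕ) : 𝓞 ℚ) ∈ v.asIdeal}, ∀ 𝔓 ∈ v.primesAbove,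
            resLe (cofreeTorsionGaloisModule S ρ ((p ^ k : ℕ) : ℤ)).toTopRep
              (inf_le_left : κ.layerSubgroup n ⊓ 𝔓.inertia (absoluteGaloisGroup ℚ) ≤ κ.layerSubgroup n) 1 b = 0 := by
  obtain ⟨n, hn, k, hk, b, hb⟩ := exists_transferH1_eq S ρ κ n₀ k₀ s
  exact ⟨n, hn, k, hk, b, hb, admissible_of_transferH1_mem_unramifiedOutside S ρ κ hρ _ n b (hb ▸ hs)⟩

end Global

/-! ## §3 The 2-adic reading of a descended class: K2, K1, DescKumAt (typed `Prop`s — the sub-stubs to be proved) -/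

section AtP

variable {p : ℕ} [Fact p.Prime] (S : Set (PadicAlgCl p)) {d : ℕ} (ρ : FramedGaloisRep ℚ ↥(padicCoeffIntegers S) d)
  (κ : ZpExtension ℚ p) (W : WeierstrassCurve ℚ) [W.IsElliptic] {r : ℕ}
  (Θ : Cofree ρ ↥(padicCoeffField S) ≃+ (Fin r → ↥(W.geomPrimaryTorsion p))) (v : HeightOneSpectrum (𝓞 ℚ))
  (hΘ : ∀ (δ : absoluteGaloisGroup (v.adicCompletion ℚ)) (m : Cofree ρ ↥(padicCoeffField S)) (i : Fin r),
    Θ (resGalOfEmb (closureEmb (K := ℚ) (v.adicCompletion ℚ)) δ • m) i =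
      resGalOfEmb (closureEmb (K := ℚ) (v.adicCompletion ℚ)) δ • Θ m i)

/-- `U_∞ ≤ Γ_{ℚ_v}`: the local Galois group of `ℚ_{∞,v}` (preimage of `Γ_∞` under `Γ_{ℚ_v} → Γ_ℚ`), below every `U_n = layerGroup κ v n`.
[cite: Kobayashi2003, Def. 1.1] -/
abbrev towerGroup : Subgroup (absoluteGaloisGroup (v.adicCompletion ℚ)) :=
  localSubgroupOfEmb κ.kerSubgroup (closureEmb (K := ℚ) (v.adicCompletion ℚ))

theorem towerGroup_le_layerGroup (n : ℕ) : towerGroup κ v ≤ layerGroup κ v n :=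
  Subgroup.comap_mono (κ.kerSubgroup_le_layerSubgroup n)

theorem layerGroup_le_of_le {n m : ℕ} (h : n ≤ m) : layerGroup κ v m ≤ layerGroup κ v n :=
  Subgroup.comap_mono (κ.layerSubgroup_antitone h)

/-- **K2 (local level shift at `v`; sub-stub, to be proved).** A class of `H¹(U_n, A_ρ)` (`A_ρ = A_ρ[0]`) that dies on `U_∞` already dies on
some `U_m`, `m ≥ n`: `H¹(U_∞, A) = lim→_m H¹(U_m, A)` for the discrete `A` and `U_∞ = ⋂ U_m` (compactness: a coboundary on `U_∞` extends to
a neighbourhood `U_m`).  `ρ`/local-side twin of the landed W-currency `UniversalToricDescentRelaxedLocalLevelShift.exists_resOfLe_layer_inf_decomp_eq_zero`.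
[cite: SerreGaloisCohomology1997, I §2.2 Prop. 8] [cite: NeukirchSchmidtWingberg2008, (1.5.1)] -/
def LocalLevelShift : Prop :=
  ∀ (n : ℕ) (y : continuousCohomology 1 (subgroupRep (cofreeTorsionLocalRep S ρ 0 v) (layerGroup κ v n))),
    resLe (cofreeTorsionLocalRep S ρ 0 v) (H := towerGroup κ v) (H' := layerGroup κ v n) (towerGroup_le_layerGroup κ v n) 1 y = 0 →
      ∃ m : ℕ, ∃ h : n ≤ m,
        resLe (cofreeTorsionLocalRep S ρ 0 v) (H := layerGroup κ v m) (H' := layerGroup κ v n) (layerGroup_le_of_le κ v h) 1 y = 0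

/-- **K1 (the kernel of `H¹(U_m, A_ρ[p^k]) → H¹(U_m, A_ρ)` consists of Θ-Kummer classes of TORSION tuples; sub-stub, to be proved).**
If a cocycle `γ` of `U_m` with values in `A_ρ[p^k]` is an `A_ρ`-coboundary `τ ↦ τ a − a`, then `p^k a ∈ A_ρ^{U_m}`, `T := ι(Θ(p^k a)) ∈ E(ℚ_{m,v})^r`
is a torsion tuple with roots `ι(Θ a)`, and `[γ] = thetaLayerKummer … m T` (the Kummer cocycle of the root, read through `hΘ`; T3♮ §1 bookkeeping).
[cite: Kobayashi2003, §2 (p. 4), (8.23) (p. 18)] [cite: SilvermanAEC2009, VIII §2] [cite: Greenberg1989, §1 p. 98] -/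
def KerToCofreeIsThetaKummerTorsion (k : ℕ) : Prop :=
  ∀ (m : ℕ) (γ : contOneCocycles (subgroupRep (cofreeTorsionLocalRep S ρ ((p ^ k : ℕ) : ℤ) v) (layerGroup κ v m)))
    (a : Cofree ρ ↥(padicCoeffField S)),
    (∀ τ : ↥(layerGroup κ v m),
      ((γ.1 τ : ↥(AddSubgroup.torsionBy (Cofree ρ ↥(padicCoeffField S)) ((p ^ k : ℕ) : ℤ))) : Cofree ρ ↥(padicCoeffField S)) =
        resGalOfEmb (closureEmb (K := ℚ) (v.adicCompletion ℚ)) (τ : absoluteGaloisGroup (v.adicCompletion ℚ)) • a - a) →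
    ∃ T : Fin r → ↥(localLayerPointsOfEmb κ (closureEmb (K := ℚ) (v.adicCompletion ℚ)) W m),
      (∀ i, ∃ e : ℕ, p ^ e • (T i : localPoints W (v.adicCompletion ℚ)) = 0) ∧
      oneCocycleClass _ γ = thetaLayerKummer S ρ k W Θ κ v hΘ m T

/-- **DescKumAt (the [kum] reading of a descended class; the 2-adic sub-stub's TARGET).** `s` is `τ_{n,k} b` for some deep `n ≥ n₀`, some
`k`, a level class `b` and a tuple `Q₁ ∈ E(ℚ_{n,v})^r` with `layerLocOf b = thetaLayerKummer Q₁` — verbatim the hypothesis `hkum` of T3♮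
(`exists_thetaKummerWitness_of_layerLocOf_eq_thetaLayerKummer`) and of the S4₂ assembly (`exists_iwasawaH1_locd₂_eq_strict_of_levelwise_orthogonal`).
CLAIM of the card: clause (3♭) of `SelRel` for `s` at `v` ⟹ `DescKumAt`, via D1 (`k ≥ k'`, `n ≥` the levels of the witness points) + K2 + K1 +
additivity of `thetaLayerKummer` + the landed level/exponent compatibilities (`resLe_thetaLayerKummer`, `cohomologyMap_cofreeTorsionLocalPow_thetaLayerKummer`).
[cite: Kobayashi2003, (8.23)] [cite: GreenbergLNM1716, §3 Lemma 3.2] -/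
def DescKumAt (n₀ : ℕ) (s : subgroupH1 κ.kerSubgroup (Cofree ρ ↥(padicCoeffField S))) : Prop :=
  ∃ n : ℕ, n₀ ≤ n ∧ ∃ (k : ℕ) (b : H1 (cofreeTorsionGaloisModule S ρ ((p ^ k : ℕ) : ℤ)) (κ.layerSubgroup n))
    (Q₁ : Fin r → ↥(localLayerPointsOfEmb κ (closureEmb (K := ℚ) (v.adicCompletion ℚ)) W n)),
    resOfLe (Cofree ρ ↥(padicCoeffField S)) (κ.kerSubgroup_le_layerSubgroup n)
        (pushH1 (κ.layerSubgroup n) (AddSubgroup.torsionBy (Cofree ρ ↥(padicCoeffField S)) ((p ^ k : ℕ) : ℤ)).subtype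
          (torsionBy_subtype_smul S ρ ((p ^ k : ℕ) : ℤ)) b) = s ∧
      layerLocOf (cofreeTorsionGaloisModule S ρ ((p ^ k : ℕ) : ℤ)) κ v n b = thetaLayerKummer S ρ k W Θ κ v hΘ n Q₁

end AtP

end Summit.BirchSwinnertonDyer.BirchSwinnertonDyer.Cruxes.ResidualThetaCountLowerPureAtTwo.SideaK3G16

end
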